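import Mathlib

/-!
# The first-order residual of the star border family of `P₅` lives on type-`(2,2,1)` words only
# (Negative lane of stmt-ValiantsHypothesis-24813; priced check (ii) F1 of director-valiant b126 (2), decided analytically; val-neg-2 g2)

`LaplaceFiveBorder.laplaceOptimal_five_border` (✓ p629937, val-neg-2 g1) exhibits the star-profile degeneration
`Σ_t u_t(ε) w_t(ε) = P₅ + ε·E` of Laplace weight `108`, with the residual tensor
`E = M₀₂(R+U)₁₃₄ + M₀₃(R−U)₁₂₄ − ½ M₀₄ R₁₂₃` (`M = e₂₄ + e₄₂`; `R`, `U` = indicators of the arrangements of `{1,2,4}`,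
`{0,2,4}`).  The card `doubling-stratum-residue` (crux `LaplaceOptimalFive`) predicts (its P1) that along border tails the
residual LOCALISES on the depth-two stratum, word type `(2,2,1)`.  For the canonical family this is EXACT and kernel-checkable:
`twoE_support_type221` — wherever `2E ≠ 0` the word has exactly three distinct letters, none occurring three times (type
`(2,2,1)`: the tangent short factor `M` puts `{2,4}` on the slots `(0,j)` and the first-order long factor puts an arrangement
containing both `2` and `4` on the other three slots, so BOTH short letters collide).  `2E` is used to stay in `ℤ`
(the `½` cleared); `twoE_ne_zero_somewhere` records that the residual is not identically zero (support: 40 words).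
Reading for the check: P1 holds exactly for the tree's degeneration; the Levenberg–Marquardt tails of the numerical census do NOT
follow this family (their residual splits `221 : 2111 ≈ 1 : 1` down to relres `2·10⁻²`), so an LM-path share test cannot decide
P1 — the analytic answer supersedes it.  Nothing here bears on `LaplaceOptimalFive` (OPEN) or on `VP ≠ VNP` (NOT proved).
-/

set_option autoImplicit false

-- the mandated summit-side namespace repeats a component by design (single-problem summit)
set_option linter.dupNamespace false

namespace Summit.ValiantsHypothesis.ValiantsHypothesis.Theorems.LaplaceOptimalFiveNegative.LaplaceFiveBorderResidual

/-- **Support of the first-order residual `2E` of the star border family is of word type `(2,2,1)`**: three distinct letters,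
each occurring at most twice (letters `a,b,c,d,e` in slots `0..4`; kernel `decide` over the `5⁵` words). -/
theorem twoE_support_type221 : ∀ a b c d e : Fin 5,
    (2 * (if (a = 2 ∧ c = 4) ∨ (a = 4 ∧ c = 2) then (1:ℤ) else 0) * ((if (b = 1 ∧ d = 2 ∧ e = 4) ∨ (b = 1 ∧ d = 4 ∧ e = 2) ∨ (b = 2 ∧ d = 1 ∧ e = 4) ∨ (b = 2 ∧ d = 4 ∧ e = 1) ∨ (b = 4 ∧ d = 1 ∧ e = 2) ∨ (b = 4 ∧ d = 2 ∧ e = 1) then (1:ℤ) else 0) + (if (b = 0 ∧ d = 2 ∧ e = 4) ∨ (b = 0 ∧ d = 4 ∧ e = 2) ∨ (b = 2 ∧ d = 0 ∧ e = 4) ∨ (b = 2 ∧ d = 4 ∧ e = 0) ∨ (b = 4 ∧ d = 0 ∧ e = 2) ∨ (b = 4 ∧ d = 2 ∧ e = 0) then (1:ℤ) else 0)) + 2 * (if (a = 2 ∧ d = 4) ∨ (a = 4 ∧ d = 2) then (1:ℤ) else 0) * ((if (b = 1 ∧ c = 2 ∧ e = 4) ∨ (b = 1 ∧ c = 4 ∧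 e = 2) ∨ (b = 2 ∧ c = 1 ∧ e = 4) ∨ (b = 2 ∧ c = 4 ∧ e = 1) ∨ (b = 4 ∧ c = 1 ∧ e = 2) ∨ (b = 4 ∧ c = 2 ∧ e = 1) then (1:ℤ) else 0) - (if (b = 0 ∧ c = 2 ∧ e = 4) ∨ (b = 0 ∧ c = 4 ∧ e = 2) ∨ (b = 2 ∧ c = 0 ∧ e = 4) ∨ (b = 2 ∧ c = 4 ∧ e = 0) ∨ (b = 4 ∧ c = 0 ∧ e = 2) ∨ (b = 4 ∧ c = 2 ∧ e = 0) then (1:ℤ) else 0)) - (if (a = 2 ∧ e = 4) ∨ (a = 4 ∧ e = 2) then (1:ℤ) else 0) * (if (b = 1 ∧ c = 2 ∧ d = 4) ∨ (b = 1 ∧ c = 4 ∧ d = 2) ∨ (b = 2 ∧ c = 1 ∧ d = 4) ∨ (b = 2 ∧ c = 4 ∧ d = 1) ∨ (b = 4 ∧ c = 1 ∧ d = 2) ∨ (b = 4 ∧ c = 2 ∧ d = 1) then (1:ℤ) else 0)) ≠ 0 →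
    (Finset.univ.image ![a, b, c, d, e]).card = 3 ∧
      ∀ x : Fin 5, (Finset.univ.filter (fun i => ![a, b, c, d, e] i = x)).card ≤ 2 := by
  decide

/-- The residual is not identically zero (e.g. at the word `(2,1,4,2,4)`: `M₀₂ = 1`, `(R+U)(1,2,4) = 1`). -/
theorem twoE_ne_zero_somewhere : ∃ a b c d e : Fin 5,
    (2 * (if (a = 2 ∧ c = 4) ∨ (a = 4 ∧ c = 2) then (1:ℤ) else 0) * ((if (b = 1 ∧ d = 2 ∧ e = 4) ∨ (b = 1 ∧ d = 4 ∧ e = 2) ∨ (b = 2 ∧ d = 1 ∧ e = 4) ∨ (b = 2 ∧ d = 4 ∧ e = 1) ∨ (b = 4 ∧ d = 1 ∧ e = 2) ∨ (b = 4 ∧ d = 2 ∧ e = 1) then (1:ℤ) else 0) + (if (b = 0 ∧ d = 2 ∧ e = 4) ∨ (b = 0 ∧ d = 4 ∧ e = 2) ∨ (b = 2 ∧ d = 0 ∧ e = 4) ∨ (b = 2 ∧ d = 4 ∧ e = 0) ∨ (b = 4 ∧ d = 0 ∧ e = 2) ∨ (b = 4 ∧ d = 2 ∧ e = 0) then (1:ℤ)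 else 0)) + 2 * (if (a = 2 ∧ d = 4) ∨ (a = 4 ∧ d = 2) then (1:ℤ) else 0) * ((if (b = 1 ∧ c = 2 ∧ e = 4) ∨ (b = 1 ∧ c = 4 ∧ e = 2) ∨ (b = 2 ∧ c = 1 ∧ e = 4) ∨ (b = 2 ∧ c = 4 ∧ e = 1) ∨ (b = 4 ∧ c = 1 ∧ e = 2) ∨ (b = 4 ∧ c = 2 ∧ e = 1) then (1:ℤ) else 0) - (if (b = 0 ∧ c = 2 ∧ e = 4) ∨ (b = 0 ∧ c = 4 ∧ e = 2) ∨ (b = 2 ∧ c = 0 ∧ e = 4) ∨ (b = 2 ∧ c = 4 ∧ e = 0) ∨ (b = 4 ∧ c = 0 ∧ e = 2) ∨ (b = 4 ∧ c = 2 ∧ e = 0) then (1:ℤ) else 0)) - (if (a = 2 ∧ e = 4) ∨ (a = 4 ∧ e = 2) then (1:ℤ) else 0) * (if (b = 1 ∧ c = 2 ∧ d = 4) ∨ (b = 1 ∧ c = 4 ∧ d = 2) ∨ (b = 2 ∧ c = 1 ∧ d = 4) ∨ (b = 2 ∧ c = 4 ∧ d = 1) ∨ (b = 4 ∧ c = 1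 ∧ d = 2) ∨ (b = 4 ∧ c = 2 ∧ d = 1) then (1:ℤ) else 0)) ≠ 0 :=
  ⟨2, 1, 4, 2, 4, by decide⟩

end Summit.ValiantsHypothesis.ValiantsHypothesis.Theorems.LaplaceOptimalFiveNegative.LaplaceFiveBorderResidual
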